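import Summits.NavierStokesRegularity.NavierStokesRegularity.Theorems.ExtremiserTransienceLerayPincerStrongPointCore
import Summits.NavierStokesRegularity.NavierStokesRegularity.Theorems.ExtremiserTransienceLerayPincerDefs
import Literature.Analysis.FluidPDE.ElgindiBlowup
import HarnessLib

/-!
# Route `ExtremiserTransience`, crux `NearExtremalTransiencePerFlow` (stmt-NavierStokesRegularity-26567) —
# LINE g11-α «Leray pincer» (ns-idea-5 g11): THE STRONG-POINT ENSTROPHY FLOOR `StrongPointBudget`, PROVED

`--supports stmt-NavierStokesRegularity-26567` (helper; prover seat ns-net-p2 g11).  `strongPointBudget_holds : StrongPointBudget` — the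
line's typed first lemma (text of record `…Theorems.NearExtremalTransiencePerFlow.LerayPincer.StrongPointBudget`, ns-net-p1 g14's
`…LerayPincerDefs`, VERBATIM the crux workfile `Cruxes/NearExtremalTransiencePerFlow/Lines/leray_pincer.lean`; idea-crit-4 g8
2026-08-29T09:11:26Z: «typed, BC7-clean, prover-grade (M) … the cheapest real seat on this line»; step (i) of the line's static stub T
`TightOfBoundedBudget`): for all `η, Z̄, B, A > 0` there are `c, D > 0` such that every smooth divergence-free `v` with `‖v‖ ≤ 1`,
`‖Dv‖ ≤ B`, enstrophy `≤ Z̄`, finite `Ḣ¹` budget and LINEAR local-energy growth `∫_{B(x,R)} ‖v‖² ≤ A R` carries local enstrophy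
`∫_{B(x₀,D)} ‖curl v‖² ≥ c` about every `η`-strong point `‖v x₀‖ ≥ η` (the hypotheses `Z̄`, `Ḣ¹` are not needed).
PROOF (weighted mean value with defect, part 1 `…LerayPincerStrongPointCore`; NOT the Biot–Savart kernel): with the unit-mass radial bump
`w = probeBump ρ` (`HarmonicProbe`) and `g = ⟪v, v x₀⟫`, the radial averages `J(s) = ∫ w(y) g(x₀ + s y) dy` satisfy `J(0) = ‖v x₀‖² ≥ η²`;
`|J(1)| ≤ η²/4` by linear growth once `ρ² ≥ 32A/(η⁴ m)` (AM–GM against `∫ w² ≤ (mρ³)⁻¹`); `|J'| ≤ 2Bρ` everywhere (gradient bound); and for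
`s ≥ δ` the core identity with defect gives `|J'(s)| ≤ ρβ + (ρ/β)(mρ³)⁻¹ δ⁻³ ∫_{B(x₀,2ρ)} ‖curl v‖²`; the two-regime mean value estimate
with `δ = min(1/2, η²/(8Bρ))`, `β = η²/(4ρ)` leaves `∫_{B(x₀,2ρ)} ‖curl v‖² ≥ η⁴ δ³ m ρ/16`.  So `D = 2ρ(η, A)`, `c = c(η, B, A)` explicit
(`m = baseBumpMass`).  HONEST FRAMING: an elementary kinematic lemma; T, Q♭, ⟨26567⟩ and NS regularity remain OPEN; no summit is proved by a
line. [cite: GilbargTrudinger2001, Thm 2.1] [folklore]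
-/

noncomputable section

open scoped Topology InnerProductSpace RealInnerProductSpace ENNReal ContDiff Laplacian
open MeasureTheory Filter Set Metric Function InnerProductSpace
open Literature.Analysis Literature.Analysis.FluidPDE

namespace Summit.NavierStokesRegularity.NavierStokesRegularity.Theorems

-- the problem directory repeats the summit name (`NavierStokesRegularity/NavierStokesRegularity`)
set_option linter.dupNamespace false

namespace NearExtremalTransiencePerFlow.LerayPincer

section Budget

open FluidPDE

set_option maxHeartbeats 800000 in -- one long assembly (three weighted estimates + bookkeeping); splits would only add plumbing
/-- **`StrongPointBudget`** (the strong-point enstrophy floor): an `η`-strong point of a smooth divergence-free field of height `≤ 1`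
with gradient bound `B` and linear local-energy growth `A` carries local enstrophy `≥ c(η,B,A)` within distance `D(η,A)`.
PROOF (weighted mean value with defect): for the unit-mass radial bump `w = probeBump ρ` and the component `g = ⟪v, v x₀⟫`,
`J(s) = ∫ w(y) g(x₀ + s y) dy` satisfies `J(0) = ‖v x₀‖² ≥ η²`, `|J(1)| ≤ η²/4` (linear growth, `ρ` large), `|J'| ≤ 2Bρ` always and
`|J'(s)| ≤ ρβ + ρ p β⁻¹ s⁻³ ∫_{B(x₀,2ρ)} ‖curl v‖²` for `s > 0` (core identity with defect, `p = (m ρ³)⁻¹`), whence the floor. -/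
theorem strongPointBudget_holds : StrongPointBudget := by
  intro η Zb B A hη hZb hB hA
  -- ### constants
  set m : ℝ := baseBumpMass (EuclideanSpace ℝ (Fin 3)) with hm
  have hm0 : 0 < m := baseBumpMass_pos
  set θ : ℝ := η ^ 2 with hθ
  have hθ0 : 0 < θ := by positivity
  set ρ : ℝ := max 1 (Real.sqrt (32 * A / (θ ^ 2 * m))) with hρ
  have hρ1 : 1 ≤ ρ := le_max_left _ _
  have hρ0 : 0 < ρ := lt_of_lt_of_le one_pos hρ1
  have hρA : 32 * A / (θ ^ 2 * m) ≤ ρ ^ 2 := by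
    calc 32 * A / (θ ^ 2 * m) = Real.sqrt (32 * A / (θ ^ 2 * m)) ^ 2 := (Real.sq_sqrt (by positivity)).symm
      _ ≤ ρ ^ 2 := pow_le_pow_left₀ (Real.sqrt_nonneg _) (le_max_right _ _) 2
  set p : ℝ := (m * ρ ^ 3)⁻¹ with hp
  have hp0 : 0 < p := by positivity
  set δ : ℝ := min (1 / 2) (θ / (8 * B * ρ)) with hδ
  have hδ0 : 0 < δ := lt_min (by norm_num) (by positivity)
  have hδ1 : δ ≤ 1 := (min_le_left _ _).trans (by norm_num)
  have hδB : 2 * B * ρ * δ ≤ θ / 4 := by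
    have : δ ≤ θ / (8 * B * ρ) := min_le_right _ _
    rw [le_div_iff₀ (by positivity)] at this
    linarith
  set β : ℝ := θ / (4 * ρ) with hβ
  have hβ0 : 0 < β := by positivity
  clear_value m θ ρ p δ β
  refine ⟨θ ^ 2 * δ ^ 3 * m * ρ / 16, 2 * ρ, by positivity, by positivity, ?_⟩
  intro v hv hdiv hv1 hDv _hZ _h1 hgr x₀ hx₀
  -- ### the weight, the component, the family
  set w : EuclideanSpace ℝ (Fin 3) → ℝ := probeBump ρ with hw
  have hwc : Continuous w := (contDiff_probeBump ρ (n := 0)).continuous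
  have hwcs : HasCompactSupport w := hasCompactSupport_probeBump hρ0
  have hwrad : ∀ x y : EuclideanSpace ℝ (Fin 3), ‖x‖ = ‖y‖ → w x = w y := fun x y h => probeBump_radial ρ h
  have hw0 : ∀ y : EuclideanSpace ℝ (Fin 3), 2 * ρ ≤ ‖y‖ → w y = 0 := fun y hy => probeBump_eq_zero hρ0 hy
  have hwnn : ∀ y, 0 ≤ w y := fun y => probeBump_nonneg hρ0 y
  have hwp : ∀ y, w y ≤ p := fun y => by
    have h := abs_probeBump_le (E := EuclideanSpace ℝ (Fin 3)) hρ0 y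
    rw [abs_of_nonneg (hwnn y), finrank_euclideanSpace_fin] at h
    simpa [hp, hm] using h
  have hwint : ∫ y, w y = 1 := integral_probeBump hρ0
  set e : EuclideanSpace ℝ (Fin 3) := v x₀ with he
  have he1 : ‖e‖ ≤ 1 := hv1 x₀
  set g : EuclideanSpace ℝ (Fin 3) → ℝ := fun z => ⟪v z, e⟫_ℝ with hg
  have hg1 : ContDiff ℝ 1 g := (hv.of_le (by norm_cast)).inner ℝ contDiff_const
  have hgle : ∀ z, |g z| ≤ ‖v z‖ := fun z =>
    (abs_real_inner_le_norm _ _).trans (by nlinarith [norm_nonneg (v z)])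
  have hDg : ∀ z y, |fderiv ℝ g z y| ≤ B * ‖y‖ := by
    intro z y
    have hd : fderiv ℝ g z y = ⟪fderiv ℝ v z y, e⟫_ℝ := by
      show fderiv ℝ (fun z => ⟪v z, e⟫_ℝ) z y = _
      rw [fderiv_inner_apply ℝ ((hv.differentiable (by simp)) z) (differentiableAt_const e)]
      simp
    rw [hd]
    calc |⟪fderiv ℝ v z y, e⟫_ℝ| ≤ ‖fderiv ℝ v z y‖ * ‖e‖ := abs_real_inner_le_norm _ _
      _ ≤ (‖fderiv ℝ v z‖ * ‖y‖) * 1 := mul_le_mul (ContinuousLinearMap.le_opNorm _ _) he1 (norm_nonneg _) (by positivity)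
      _ ≤ B * ‖y‖ := by rw [mul_one]; exact mul_le_mul_of_nonneg_right (hDv z) (norm_nonneg _)
  set J : ℝ → ℝ := fun s => ∫ y, w y * g (x₀ + s • y) with hJ
  set J' : ℝ → ℝ := fun s => ∫ y, w y * fderiv ℝ g (x₀ + s • y) y with hJ'
  have hJd : ∀ s, HasDerivAt J (J' s) s := fun s =>
    hasDerivAt_radialFamily hg1 hwc hwcs (by positivity : 0 < 2 * ρ) hw0 x₀ s
  -- ### `J 0 = ‖v x₀‖² ≥ θ`
  have hJ0 : J 0 = ‖v x₀‖ ^ 2 := by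
    simp only [hJ, hg, he, zero_smul, add_zero]
    rw [integral_mul_const, hwint, one_mul, real_inner_self_eq_norm_sq]
  have hJ0θ : θ ≤ J 0 := by
    rw [hJ0, hθ]; exact pow_le_pow_left₀ hη.le hx₀ 2
  -- ### `|J 1| ≤ θ/4`
  -- ### integrability helpers
  have hcontv : Continuous v := hv.continuous
  have hωc : Continuous (curl v) := continuous_curl (hv.of_le (by norm_cast))
  have haff : ∀ s' : ℝ, Continuous fun y : EuclideanSpace ℝ (Fin 3) => x₀ + s' • y := fun s' =>
    continuous_const.add (continuous_id.const_smul s')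
  have hind_int : ∀ (F : EuclideanSpace ℝ (Fin 3) → ℝ), Continuous F →
      Integrable ((Metric.ball (0 : EuclideanSpace ℝ (Fin 3)) (2 * ρ)).indicator F) volume := by
    intro F hF
    rw [integrable_indicator_iff measurableSet_ball]
    exact (hF.continuousOn.integrableOn_compact (isCompact_closedBall (0 : EuclideanSpace ℝ (Fin 3)) (2 * ρ))).mono_set
      Metric.ball_subset_closedBall
  have hwsq : ∫ y, w y * w y ≤ p := by
    calc ∫ y, w y * w y ≤ ∫ y, p * w y :=
          integral_mono ((hwc.mul hwc).integrable_of_hasCompactSupport hwcs.mul_right)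
            ((hwc.const_mul p).integrable_of_hasCompactSupport hwcs.mul_left) fun y =>
            mul_le_mul_of_nonneg_right (hwp y) (hwnn y)
      _ = p := by rw [integral_const_mul, hwint, mul_one]
  -- ### `|J 1| ≤ θ/4`
  set α : ℝ := θ / (4 * p) with hα
  have hα0 : 0 < α := by positivity
  have hJ1 : |J 1| ≤ θ / 4 := by
    have hmaj : ∀ y, |w y * g (x₀ + (1 : ℝ) • y)| ≤ α / 2 * (w y * w y) +
        (2 * α)⁻¹ * (Metric.ball (0 : EuclideanSpace ℝ (Fin 3)) (2 * ρ)).indicator (fun y => ‖v (x₀ + (1 : ℝ) • y)‖ ^ 2) y := by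
      intro y
      by_cases hy : y ∈ Metric.ball (0 : EuclideanSpace ℝ (Fin 3)) (2 * ρ)
      · rw [Set.indicator_of_mem hy]
        have h1 := two_mul_abs_mul_le (a := w y) (b := g (x₀ + (1 : ℝ) • y)) hα0
        have h2 : g (x₀ + (1 : ℝ) • y) ^ 2 ≤ ‖v (x₀ + (1 : ℝ) • y)‖ ^ 2 := by
          have := hgle (x₀ + (1 : ℝ) • y)
          rw [← sq_abs]; exact pow_le_pow_left₀ (abs_nonneg _) this 2
        have h3 : g (x₀ + (1 : ℝ) • y) ^ 2 / α ≤ ‖v (x₀ + (1 : ℝ) • y)‖ ^ 2 / α := div_le_div_of_nonneg_right h2 hα0.le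
        have e4 : (2 * α)⁻¹ * ‖v (x₀ + (1 : ℝ) • y)‖ ^ 2 = (‖v (x₀ + (1 : ℝ) • y)‖ ^ 2 / α) / 2 := by field_simp
        rw [e4]; nlinarith
      · have hy' : 2 * ρ ≤ ‖y‖ := by rwa [Metric.mem_ball, dist_zero_right, not_lt] at hy
        rw [Set.indicator_of_notMem hy, hw0 y hy']; simp
    have hi1 : Integrable (fun y => α / 2 * (w y * w y)) (volume : Measure (EuclideanSpace ℝ (Fin 3))) := by
      exact ((hwc.mul hwc).integrable_of_hasCompactSupport hwcs.mul_right).const_mul _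
    have hi2 : Integrable (fun y => (2 * α)⁻¹ *
        (Metric.ball (0 : EuclideanSpace ℝ (Fin 3)) (2 * ρ)).indicator (fun y => ‖v (x₀ + (1 : ℝ) • y)‖ ^ 2) y)
        (volume : Measure (EuclideanSpace ℝ (Fin 3))) := by
      exact (hind_int _ ((hcontv.comp (haff 1)).norm.pow 2)).const_mul _
    have hball : ∫ y, (Metric.ball (0 : EuclideanSpace ℝ (Fin 3)) (2 * ρ)).indicator (fun y => ‖v (x₀ + (1 : ℝ) • y)‖ ^ 2) y
        ≤ A * (2 * ρ) := by
      rw [integral_indicator_ball_comp_affine one_pos x₀ (fun z => ‖v z‖ ^ 2), one_pow, inv_one, one_mul, one_mul]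
      exact hgr x₀ (2 * ρ) (by positivity)
    calc |J 1| ≤ ∫ y, |w y * g (x₀ + (1 : ℝ) • y)| := abs_integral_le_integral_abs
      _ ≤ ∫ y, (α / 2 * (w y * w y) +
            (2 * α)⁻¹ * (Metric.ball (0 : EuclideanSpace ℝ (Fin 3)) (2 * ρ)).indicator (fun y => ‖v (x₀ + (1 : ℝ) • y)‖ ^ 2) y) :=
          integral_mono_of_nonneg (Eventually.of_forall fun y => abs_nonneg _) (hi1.add hi2) (Eventually.of_forall hmaj)
      _ = α / 2 * (∫ y, w y * w y) +
            (2 * α)⁻¹ * (∫ y, (Metric.ball (0 : EuclideanSpace ℝ (Fin 3)) (2 * ρ)).indicator (fun y => ‖v (x₀ + (1 : ℝ) • y)‖ ^ 2) y) := by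
          rw [integral_add hi1 hi2, integral_const_mul, integral_const_mul]
      _ ≤ α / 2 * p + (2 * α)⁻¹ * (A * (2 * ρ)) :=
          add_le_add (mul_le_mul_of_nonneg_left hwsq (by positivity)) (mul_le_mul_of_nonneg_left hball (by positivity))
      _ ≤ θ / 4 := by
          have e1 : α / 2 * p = θ / 8 := by rw [hα]; field_simp; ring
          have e2 : (2 * α)⁻¹ * (A * (2 * ρ)) = 4 * A / (θ * (m * ρ ^ 2)) := by
            rw [hα, hp]; field_simp
          have e3 : 4 * A / (θ * (m * ρ ^ 2)) ≤ θ / 8 := by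
            rw [div_le_div_iff₀ (by positivity) (by norm_num)]
            have := (div_le_iff₀ (by positivity)).1 hρA
            nlinarith
          linarith
  -- ### near regime: `|J' s| ≤ 2Bρ` for every `s`
  have hK1 : ∀ s, |J' s| ≤ 2 * B * ρ := by
    intro s
    calc |J' s| ≤ ∫ y, |w y * fderiv ℝ g (x₀ + s • y) y| := abs_integral_le_integral_abs
      _ ≤ ∫ y, 2 * B * ρ * w y := by
          refine integral_mono_of_nonneg (Eventually.of_forall fun y => abs_nonneg _)
            ((hwc.const_mul _).integrable_of_hasCompactSupport hwcs.mul_left) (Eventually.of_forall fun y => ?_)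
          show |w y * fderiv ℝ g (x₀ + s • y) y| ≤ 2 * B * ρ * w y
          by_cases hy : 2 * ρ ≤ ‖y‖
          · rw [hw0 y hy]; simp
          · push Not at hy
            rw [abs_mul, abs_of_nonneg (hwnn y)]
            calc w y * |fderiv ℝ g (x₀ + s • y) y| ≤ w y * (B * ‖y‖) := mul_le_mul_of_nonneg_left (hDg _ _) (hwnn y)
              _ ≤ w y * (B * (2 * ρ)) := mul_le_mul_of_nonneg_left (mul_le_mul_of_nonneg_left hy.le hB.le) (hwnn y)
              _ = 2 * B * ρ * w y := by ring
      _ = 2 * B * ρ := by rw [integral_const_mul, hwint, mul_one]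
  -- ### far regime: `|J' s| ≤ ρβ + (ρ p/(β δ³)) ε` for `s ∈ [δ, 1]`
  obtain ⟨ε, hε⟩ : ∃ ε : ℝ, ε = ∫ z in Metric.ball x₀ (2 * ρ), ‖curl v z‖ ^ 2 := ⟨_, rfl⟩
  rw [← hε]
  have hωsq_int : IntegrableOn (fun z => ‖curl v z‖ ^ 2) (Metric.ball x₀ (2 * ρ)) volume :=
    ((hωc.norm.pow 2).continuousOn.integrableOn_compact (isCompact_closedBall x₀ (2 * ρ))).mono_set Metric.ball_subset_closedBall
  have hε0 : 0 ≤ ε := by rw [hε]; exact setIntegral_nonneg measurableSet_ball fun z _ => by positivity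
  have hK2 : ∀ s ∈ Set.Icc δ 1, |J' s| ≤ ρ * β + ρ / β * (p * ((δ ^ 3)⁻¹ * ε)) := by
    intro s hs
    have hs0 : 0 < s := lt_of_lt_of_le hδ0 hs.1
    have hB' := abs_integral_radial_mul_fderiv_inner_zoom_le hv hdiv hwc hwcs hwrad e x₀ hs0.ne'
    -- pointwise majorant of the defect integrand
    have hmaj : ∀ y, |w y| * ‖y‖ * ‖curl v (x₀ + s • y)‖ ≤ ρ * β * w y +
        ρ / β * (p * (Metric.ball (0 : EuclideanSpace ℝ (Fin 3)) (2 * ρ)).indicator (fun y => ‖curl v (x₀ + s • y)‖ ^ 2) y) := by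
      intro y
      by_cases hy : y ∈ Metric.ball (0 : EuclideanSpace ℝ (Fin 3)) (2 * ρ)
      · rw [Set.indicator_of_mem hy, abs_of_nonneg (hwnn y)]
        have hy' : ‖y‖ < 2 * ρ := by rwa [Metric.mem_ball, dist_zero_right] at hy
        have ham : 2 * ‖curl v (x₀ + s • y)‖ ≤ β + ‖curl v (x₀ + s • y)‖ ^ 2 / β := by
          have h := two_mul_abs_mul_le (a := (1 : ℝ)) (b := ‖curl v (x₀ + s • y)‖) hβ0
          rw [one_mul, abs_of_nonneg (norm_nonneg _), one_pow, mul_one] at h; exact h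
        have hw1 : w y * ‖curl v (x₀ + s • y)‖ ^ 2 ≤ p * ‖curl v (x₀ + s • y)‖ ^ 2 :=
          mul_le_mul_of_nonneg_right (hwp y) (by positivity)
        calc w y * ‖y‖ * ‖curl v (x₀ + s • y)‖ ≤ w y * (2 * ρ) * ‖curl v (x₀ + s • y)‖ := by gcongr; exact hwnn y
          _ = ρ * w y * (2 * ‖curl v (x₀ + s • y)‖) := by ring
          _ ≤ ρ * w y * (β + ‖curl v (x₀ + s • y)‖ ^ 2 / β) := mul_le_mul_of_nonneg_left ham (mul_nonneg hρ0.le (hwnn y))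
          _ = ρ * β * w y + ρ / β * (w y * ‖curl v (x₀ + s • y)‖ ^ 2) := by rw [div_eq_mul_inv, div_eq_mul_inv]; ring
          _ ≤ ρ * β * w y + ρ / β * (p * ‖curl v (x₀ + s • y)‖ ^ 2) := by gcongr
      · have hy' : 2 * ρ ≤ ‖y‖ := by rwa [Metric.mem_ball, dist_zero_right, not_lt] at hy
        rw [Set.indicator_of_notMem hy, hw0 y hy']; simp
    have hI : ∫ y, (Metric.ball (0 : EuclideanSpace ℝ (Fin 3)) (2 * ρ)).indicator (fun y => ‖curl v (x₀ + s • y)‖ ^ 2) y ≤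
        (δ ^ 3)⁻¹ * ε := by
      rw [integral_indicator_ball_comp_affine hs0 x₀ (fun z => ‖curl v z‖ ^ 2)]
      have hsub : Metric.ball x₀ (s * (2 * ρ)) ⊆ Metric.ball x₀ (2 * ρ) :=
        Metric.ball_subset_ball (by nlinarith [hs.2, hρ0])
      have hmono : ∫ z in Metric.ball x₀ (s * (2 * ρ)), ‖curl v z‖ ^ 2 ≤ ε := by
        rw [hε]
        exact setIntegral_mono_set hωsq_int (Eventually.of_forall fun z => sq_nonneg ‖curl v z‖) hsub.eventuallyLE
      have hs3 : (s ^ 3)⁻¹ ≤ (δ ^ 3)⁻¹ := by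
        apply inv_anti₀ (by positivity); exact pow_le_pow_left₀ hδ0.le hs.1 3
      calc (s ^ 3)⁻¹ * ∫ z in Metric.ball x₀ (s * (2 * ρ)), ‖curl v z‖ ^ 2 ≤ (s ^ 3)⁻¹ * ε :=
            mul_le_mul_of_nonneg_left hmono (by positivity)
        _ ≤ (δ ^ 3)⁻¹ * ε := mul_le_mul_of_nonneg_right hs3 hε0
    have hj1 : Integrable (fun y => ρ * β * w y) (volume : Measure (EuclideanSpace ℝ (Fin 3))) := by
      exact (hwc.const_mul _).integrable_of_hasCompactSupport hwcs.mul_left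
    have hj2 : Integrable (fun y => ρ / β * (p *
        (Metric.ball (0 : EuclideanSpace ℝ (Fin 3)) (2 * ρ)).indicator (fun y => ‖curl v (x₀ + s • y)‖ ^ 2) y))
        (volume : Measure (EuclideanSpace ℝ (Fin 3))) := by
      exact ((hind_int _ ((hωc.comp (haff s)).norm.pow 2)).const_mul _).const_mul _
    calc |J' s| ≤ ‖e‖ * ∫ y, |w y| * ‖y‖ * ‖curl v (x₀ + s • y)‖ := hB'
      _ ≤ 1 * ∫ y, |w y| * ‖y‖ * ‖curl v (x₀ + s • y)‖ :=
          mul_le_mul_of_nonneg_right he1 (integral_nonneg fun y => by positivity)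
      _ ≤ ∫ y, (ρ * β * w y +
            ρ / β * (p * (Metric.ball (0 : EuclideanSpace ℝ (Fin 3)) (2 * ρ)).indicator (fun y => ‖curl v (x₀ + s • y)‖ ^ 2) y)) := by
          rw [one_mul]
          exact integral_mono_of_nonneg (Eventually.of_forall fun y => by positivity) (hj1.add hj2) (Eventually.of_forall hmaj)
      _ = ρ * β * (∫ y, w y) +
            ρ / β * (p * (∫ y, (Metric.ball (0 : EuclideanSpace ℝ (Fin 3)) (2 * ρ)).indicator (fun y => ‖curl v (x₀ + s • y)‖ ^ 2) y)) := by
          rw [integral_add hj1 hj2, integral_const_mul, integral_const_mul, integral_const_mul]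
      _ ≤ ρ * β * 1 + ρ / β * (p * ((δ ^ 3)⁻¹ * ε)) := by rw [hwint]; gcongr
      _ = ρ * β + ρ / β * (p * ((δ ^ 3)⁻¹ * ε)) := by rw [mul_one]
  -- ### conclusion
  set Q : ℝ := ρ / β * (p * ((δ ^ 3)⁻¹ * ε)) with hQ
  have hQ0 : 0 ≤ Q := by
    rw [hQ]
    exact mul_nonneg (div_nonneg hρ0.le hβ0.le) (mul_nonneg hp0.le (mul_nonneg (inv_nonneg.2 (pow_nonneg hδ0.le 3)) hε0))
  clear_value Q
  have hdiff : |J 1 - J 0| ≤ δ * (2 * B * ρ) + (1 - δ) * (ρ * β + Q) :=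
    abs_sub_le_of_deriv_two_regimes hJd hδ0.le hδ1 (fun s _ => hK1 s) hK2
  have hmain : θ ≤ θ / 4 + θ / 4 + θ / 4 + Q := by
    have h1 : J 0 ≤ |J 1| + |J 1 - J 0| := by
      have := abs_sub_abs_le_abs_sub (J 0) (J 1)
      rw [abs_sub_comm] at this
      linarith [le_abs_self (J 0)]
    have h2 : δ * (2 * B * ρ) ≤ θ / 4 := by nlinarith
    have h3 : (1 - δ) * (ρ * β + Q) ≤ ρ * β + Q := by nlinarith
    have h4 : ρ * β = θ / 4 := by rw [hβ]; field_simp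
    linarith
  have hfin : θ / 4 ≤ Q := by linarith
  -- unfold the constants: `Q = 4 ε / (θ m ρ δ³)`
  have key : ∀ E : ℝ, ρ / β * (p * ((δ ^ 3)⁻¹ * E)) = E * 4 / (θ * m * ρ * δ ^ 3) := by
    intro E
    have h1 : θ ≠ 0 := hθ0.ne'
    have h2 : m ≠ 0 := hm0.ne'
    have h3 : ρ ≠ 0 := hρ0.ne'
    have h4 : δ ≠ 0 := hδ0.ne'
    rw [hβ, hp]; field_simp
  have hden : 0 < θ * m * ρ * δ ^ 3 := by positivity
  rw [hQ, key ε, le_div_iff₀ hden] at hfin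
  rw [div_le_iff₀ (by norm_num : (0 : ℝ) < 16)]
  have e6 : θ ^ 2 * δ ^ 3 * m * ρ = θ * (θ * m * ρ * δ ^ 3) := by ring
  rw [e6]
  linarith

end Budget

end NearExtremalTransiencePerFlow.LerayPincer

end Summit.NavierStokesRegularity.NavierStokesRegularity.Theorems

end
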